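import Literature.RepresentationTheory.FiniteGroups.SymmetricGroupCharacterEvaluation
import HarnessLib

/-!
# Bürgisser–Ikenmeyer 2017, Ex. 5.6 / Rem. 5.18: kernel certificates for `k_6(5) > 0` (`S_{30}`), part B

P. Bürgisser, C. Ikenmeyer, *Fundamental invariants of orbit closures*, J. Algebra **477** (2017)
390–434 = arXiv:1511.02927 [BurgisserIkenmeyer2017], Ex. 5.6 and Rem. 5.18 (held text
`paper:arxiv-1511.02927` p0018:L125, p0020): "`E'(5) = E'(6) = E'(8) = E'(9) = {0,3,4,5,6,…}`" (Ex. 5.6: `5 ∈ E'(6)`) (computations with the DERKSEN program in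
print; `k_m(δ) = g(m×δ, m×δ, m×δ)`, the Kronecker coefficient of three `m × δ` rectangles, BI §5
eq. (5.2)). KERNEL CERTIFICATES ONLY (theorems; no definition, no named fact), part of a PARTIAL
proof of the named fact `BI2017_ex_5_6` of `BI17FundamentalInvariantTensors.lean` (val-lit row
BI2017-B), assembled in `BI17Ex56SmallCases.lean`. Each `decide +kernel` theorem below is one CHUNK
of the class sum `n! · g(λ, λ, λ) = ∑_ρ #C_ρ χ^λ(ρ)³` (`MNEval.kronSum`, the tree's verified
Murnaghan–Nakayama evaluator,
`Literature/RepresentationTheory/FiniteGroups/SymmetricGroupCharacterEvaluation.lean`): the sum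
over the cycle types `ρ` of `S_{30}` with a given largest cycle length `p` (tails
`MNEval.cycleTypesAux 29 (30-p) p`), exactly the chunking of `Ex55.kronSum_succ_eq_chunks`
(`BI17Ex55KroneckerTable.lean`, val-lit x4) — forced by the kernel's memory guard: the whole sum
(`5604` classes on a `6`-row shape) exceeds it in one `decide` (measured: "(kernel) excessive
memory consumption detected" after 325 s for `S_28`). Chunks with `p ≥ 11` vanish termwise
(`p` exceeds the largest hook length `10` of the rectangle, so `χ^λ(ρ) = 0`) and are cheap.
Every integer on a right-hand side was produced by an independent Murnaghan–Nakayama script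
(rim-hook recursion on β-numbers) and is CHECKED here by the kernel; nothing is trusted.

Honest framing: typed-literature bookkeeping for the cell `val-lit` (LADDER-VALIANT V3, a
known-results layer); nothing here bears on VP versus VNP.

This file: `n = 30`, `λ = (5,5,5,5,5,5)`, largest cycle lengths `p ∈ {6, 7}`.
-/

open Literature.RepresentationTheory.FiniteGroups MNEval

namespace Literature.Computability.AlgebraicComplexity

namespace Ex56

set_option maxHeartbeats 100000000
set_option maxRecDepth 100000

/-- Chunk `p = 6` of `30! · k_6(5)`: the cycle types of `S_30` with largest cycle length `6`.
[cite: BurgisserIkenmeyer2017, Ex. 5.6] -/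
theorem chunk30_6 :
    (((cycleTypesAux 29 24 6).map fun l => kronTerm 30 [5, 5, 5, 5, 5, 5] [5, 5, 5, 5, 5, 5] [5, 5, 5, 5, 5, 5] (6 :: l))).sum =
      129935302337098777854246912000000 := by
  decide +kernel

/-- Chunk `p = 7` of `30! · k_6(5)`: the cycle types of `S_30` with largest cycle length `7`.
[cite: BurgisserIkenmeyer2017, Ex. 5.6] -/
theorem chunk30_7 :
    (((cycleTypesAux 29 23 7).map fun l => kronTerm 30 [5, 5, 5, 5, 5, 5] [5, 5, 5, 5, 5, 5] [5, 5, 5, 5, 5, 5] (7 :: l))).sum =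
      (-378362324559364804157571072000000) := by
  decide +kernel

end Ex56

end Literature.Computability.AlgebraicComplexity
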